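import Summits.Langlands.Langlands.Theses.IrreducibilityBySelfDuality
import Literature.NumberTheory.Automorphic.SelfdualGL3AdjointLiftProofs
import Literature.NumberTheory.Automorphic.ArchParameterUnique

/-!
# Line `half-central-character` — checked skeleton for the crux
`Summit.Langlands.Langlands.Theses.IrreducibilityBySelfDuality.RegularAdjointLiftCM` (stmt-Langlands-13617)

Planner crux-plan (round 1, 2026-08-16), idea card `Ideas/half-central-character.md` (triage r1-1/2/3:
pass; merge representative of {half-central-character, centre-vs-sl2-parity, square-class-central-character}).
Line card: `Lines/half-central-character.md`.

## Shape of the line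

The crux is, definitionally, `SelfdualGL3AdjointLift → CMStep` (standing `Disproof.lean` §1,
`regularAdjointLiftCM_iff`): given Ramakrishnan's Satake-level descent `(σ₀, ν)` of a regular algebraic,
essentially self-dual cuspidal `π` on `GL₃` over a CM field `K`, produce a REGULAR ALGEBRAIC `σ` and an
algebraic `ν` with `t_π = ν · Ad(t_σ)` a.e. and `σ` non-dihedral.  The card's lever: the regular algebraic
member of the adversarial twist class `{σ₀ ⊗ χ}` is cut out by its CENTRAL CHARACTER — `σ₀ ⊗ χ` is regular
algebraic iff `χ_∞² = ‖·‖_∞ ω_{σ₀,∞}⁻¹ B_∞` for an integral-type `B` of the parity of the weight gaps of `π` —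
so the CM step splits into

* `C⁺_arch` (any number field): archimedean bookkeeping on Harish-Chandra parameters — the five registered
  stubs below (`stub_adjointArchShape` = the printed INPUT Gelbart–Jacquet at `∞` + JS II Thm 4.4;
  `stub_purity` = Clozel's purity lemma on multisets; `stub_centralCharacterArch`,
  `stub_twistArchShift`, `stub_raCertificate` = tree plumbing), and
* `C⁺_GL1` (the CM content, GL(1) data only): "half the central character" = the route's OWN rank-4 item
  `HalfIntegralTwistCM` (stmt-Langlands-14036), used BY NAME as the panel asked (TRIAGE-r1-2 §half,
  TRIAGE-r1-3 §centre: "identify the GL(1) transfer with the filed item rather than filing a twin stub");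
  its intended proof is the card's `χ := √Θ`, `Θ = ‖·‖ω_{σ₀}⁻¹B`, Weil's unit criterion ONCE on `V²`
  (`ψ(v²) = Θ(v)`; first lemma `exists_heckeCharacter_half_of_sq` proved modulo the Weil fact by triage
  r1-2, `W2.lean`), and its standing disprover (`Cruxes/HalfIntegralTwistCM/Disproof.lean`) reads it
  TRUE as typed with hypotheses (ii) and `IsCMField` load-bearing.

The composition `RegularAdjointLiftCM_of` is kernel-checked (no `sorry` outside the five stubs):
Thm A ⟹ `(σ₀, ν)`; Satake uniqueness ⟹ `AdRel π σ₀ ν`; stub A ⟹ HC parameters `{p₁, p₂}` of `σ₀`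
(integrally paired with their conjugates), `{c}` of `ν`, `{p₁-p₂+c, c, p₂-p₁+c}` of `π`; regular
algebraicity of `π` read on that parameter (`readout`, proved: Harish-Chandra uniqueness) ⟹ `c ι ∈ ℤ`,
`a ι := p₁ ι - p₂ ι ∈ ℤ ∖ {0}`; purity (stub P) ⟹ `a ῑ = ± a ι` (sum and sum of squares of the two
3-multisets) ⟹ `a ι + a ῑ` even; stub C ⟹ a GL(1) datum `ω` with parameter `{p₁ + p₂}`; these are EXACTLY
hypotheses (i)–(iv) of `HalfIntegralTwistCM` with `s₁ = p₁, s₂ = p₂`, which returns `χ` with parameter `{p}`,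
`p + p₁ ∈ ½ + ℤ`; stub T ⟹ `σ := σ₀ ⊗ χ` with `t_σ = c_v t_{σ₀}` a.e. and parameter `{p₁ + p, p₂ + p}`;
stub R (n = 2: entries in `½ + ℤ`, distinct since `a ≠ 0`) ⟹ `σ` regular algebraic; stub R (n = 1: `c ∈ ℤ`)
⟹ `ν` algebraic; `NonDihedral` and `AdRel` are transported along the Satake twist (Disproof §3, re-proved
here since `Disproof.lean` is not importable: `adParams_map_mul`, `nonDihedral_of_isSatakeTwistOf`,
`adRel_of_isSatakeTwistOf`).

## Disproof used (`Cruxes/RegularAdjointLiftCM/Disproof.lean`, cdisprove cycle 1, verdict "resists")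

§1 anatomy (`RegularAdjointLiftCM = SelfdualGL3AdjointLift → CMStep`): the composition `intro`s Thm A and
proves `CMStep`'s four conjuncts. §3: the Satake half is free — only `σ.IsRegularAlgebraic` and
`ν.IsRegularAlgebraic` are proved from stubs; `NuAlgebraicInput` is discharged by stub A + `readout` + stub R
(n = 1) (the `nu-cubed` card's GL(1) route is an alternative proof of that conjunct, not needed here).
§4 load-bearing hypotheses: `IsCMField` is consumed at exactly one place, the call of `HalfIntegralTwistCM`
(consistent with `CMStepAnyField` / `CMStepTotallyComplex` being false on paper and with
`halfIntegralTwistCM_false_without_isCMField`, kernel-checked in the sibling Disproof); `IsRegularAlgebraic`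
of `π` is consumed twice by `readout` (integrality of `c, a`; `a ≠ 0` from regularity), consistent with
`CMStepCAlgebraic` false.  §5 false strengthenings avoided: `ν` is Thm A's `ν`, not claimed trivial (S1);
`σ` not claimed unique (S2: `p` is whatever r4 returns); no finite-order claim on `ω_σ` (S3) or `χ` (S4).
No `_false_without_` theorem and no landed `Negative/` lemma exists for this crux (nothing to import);
the sibling's `halfIntegralTwistCM_false_without_conjInt` (hypothesis (ii) of r4 load-bearing) is honoured:
stub A exports the integral pairing `p₁ ι - p₁ ῑ ∈ ℤ` that feeds (ii).
-/

set_option linter.dupNamespace false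
set_option linter.unusedVariables false

noncomputable section

open scoped BigOperators Classical
open Filter IsDedekindDomain NumberField
open Literature.NumberTheory.Automorphic

namespace Summit.Langlands.Langlands.Cruxes.RegularAdjointLiftCM.HalfCentralCharacter

open Summit.Langlands.Langlands.Theses.IrreducibilityBySelfDuality

/-! ## §0 Vocabulary — definitional abbreviations of the route text (verbatim Disproof §1) -/

section Defs

variable {K : Type} [Field K] [NumberField K]

/-- The inlined quadratic sign `ε_{L/K}(v)` of the route text: `+1` iff some prime of `L` over `v` has
residue degree `1`, else `-1`. -/
def quadSign (L : Type) [Field L] [NumberField L] [Algebra K L] (v : HeightOneSpectrum (𝓞 K)) : ℂ :=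
  if ∃ w : HeightOneSpectrum (𝓞 L), w.asIdeal.under (𝓞 K) = v.asIdeal ∧ w.asIdeal.inertiaDeg (𝓞 K) = 1
  then (1 : ℂ) else -1

/-- `σ` (cuspidal on `GL₂/K`) is **non-dihedral at Satake level** (verbatim the route text). -/
def NonDihedral {h2 : isCompact_glFiniteIntegralLevel 2 K} (σ : CuspidalAutomorphicRepData 2 K h2) :
    Prop :=
  ∀ (L : Type) [Field L] [NumberField L] [Algebra K L], Module.finrank K L = 2 →
    ¬ (∀ᶠ v in cofinite, ∀ β : Multiset ℂ, σ.1.HasSatakeParamAt v β →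
        β.map (fun b => quadSign L v * b) = β)

/-- **The adjoint relation at Satake level** `t_{π,v} = d_v · Ad(t_{σ,v})` a.e. (verbatim the route
text; `adParams β = ((β ×ˢ β).map (p ↦ p.1 p.2⁻¹)).erase 1` definitionally). -/
def AdRel {h3 : isCompact_glFiniteIntegralLevel 3 K} {h2 : isCompact_glFiniteIntegralLevel 2 K}
    {h1 : isCompact_glFiniteIntegralLevel 1 K} (π : CuspidalAutomorphicRepData 3 K h3)
    (σ : CuspidalAutomorphicRepData 2 K h2) (ν : CuspidalAutomorphicRepData 1 K h1) : Prop :=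
  ∀ᶠ v in cofinite, ∀ α β : Multiset ℂ, π.1.HasSatakeParamAt v α → σ.1.HasSatakeParamAt v β →
    ∃ d : ℂ, ν.1.HasSatakeParamAt v {d} ∧ α = (adParams β).map (fun c => d * c)

/-- `σ` is an **a.e. Satake twist** of `σ₀` by the GL(1) datum `χ`: a.e. `t_{σ,v} = c_v t_{σ₀,v}`
(verbatim the output clause of the sibling crux `RegularTwistCM` and of `stub_twistArchShift`). -/
def IsSatakeTwistOf {h2 : isCompact_glFiniteIntegralLevel 2 K} {h1 : isCompact_glFiniteIntegralLevel 1 K}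
    (σ σ₀ : CuspidalAutomorphicRepData 2 K h2) (χ : CuspidalAutomorphicRepData 1 K h1) : Prop :=
  ∀ᶠ v in cofinite, ∀ β : Multiset ℂ, σ₀.1.HasSatakeParamAt v β →
    ∃ c : ℂ, χ.1.HasSatakeParamAt v {c} ∧ σ.1.HasSatakeParamAt v (β.map (fun b => c * b))

end Defs

/-! ## §1 The five registered stubs (statements expanded over existing declarations only) -/

/-- **STUB A — `stub_adjointArchShape` (INPUT; XL; any number field; HARDEST).**  The archimedean
adjoint identity in Harish-Chandra-parameter language: if `σ₀` is cuspidal non-dihedral on `GL₂(𝔸_K)`,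
`ν` a GL(1) datum and `π` cuspidal on `GL₃(𝔸_K)` with `t_{π,v} = d_v · Ad(t_{σ₀,v})` a.e., then there are
exponent functions `p₁ p₂ c` on the complex embeddings with: `σ₀` has archimedean parameter `{p₁ ι, p₂ ι}`,
INTEGRALLY PAIRED with its conjugate (`p₁ ι - p₁ ῑ ∈ ℤ`; the labelling at `ῑ` is chosen from a well-formed
infinity type of `σ₀`), `ν` has parameter `{c ι}`, and `π` has parameter
`{p₁ ι - p₂ ι + c ι, c ι, p₂ ι - p₁ ι + c ι} = Ad{p₁, p₂} + c`.
Why plausibly true: Gelbart–Jacquet 1978 Thm (9.3) (the lift `Ad(σ₀)` is cuspidal automorphic with local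
components `Ad(σ₀,w)` at EVERY place, in particular `w ∣ ∞`, where the local Langlands parameter of
`Ad(σ₀,w) ⊗ ν_w` restricted to `ℂˣ` is `z^{p₁-p₂+c} ⊕ z^{c} ⊕ z^{p₂-p₁+c}` up to `z̄`-exponents) + strong
multiplicity one WITH archimedean components (Jacquet–Shalika 1981 II Thm 4.4; in tree modulo two named
facts: `CuspidalAutomorphicRepData.hasArchParameter_eq_of_isNearlyEquivalent`) applied to `π` and
`Ad(σ₀) ⊗ ν` (nearly equivalent by `AdRel`; the twist datum and its parameter are `stub_twistArchShift`) +
admissibility of `σ₀,w` (integral pairing = the named fact `AutomorphicRepData.exists_hasInfinityType` for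
`σ₀`, read through `hasArchParameter_unique`) + existence of parameters (`exists_hasArchParameter_glOne` for
`ν`).  The tree's `GelbartJacquet_adjoint_lift` is Satake-level only: the archimedean clause of GJ is the
one printed input of the line with no tree shadow (vendor as a named fact
`GelbartJacquet_adjoint_lift_archimedean`, then this stub is tree plumbing).  Leans on (by name):
`GelbartJacquet_adjoint_lift` (fact), `hasArchParameter_eq_of_isNearlyEquivalent`,
`hasSatakeParamAt_iff_L2` / `strong_multiplicity_one_gl_sphericalLevel` (facts), `exists_hasInfinityType`
(fact), `hasArchParameter_unique`, `exists_hasArchParameter_glOne`,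
`CuspidalAutomorphicRepData.exists_twist_hecke_hasSatakeParamAt`.
[cite: GelbartJacquet1978, Thm (9.3)] [cite: JacquetShalikaAJM1981II, Thm 4.4] -/
theorem stub_adjointArchShape :
    ∀ (K : Type) [Field K] [NumberField K] (h1 : isCompact_glFiniteIntegralLevel 1 K)
      (h2 : isCompact_glFiniteIntegralLevel 2 K) (h3 : isCompact_glFiniteIntegralLevel 3 K)
      (π : CuspidalAutomorphicRepData 3 K h3) (σ₀ : CuspidalAutomorphicRepData 2 K h2)
      (ν : CuspidalAutomorphicRepData 1 K h1),
      (∀ (L : Type) [Field L] [NumberField L] [Algebra K L], Module.finrank K L = 2 →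
        ¬ (∀ᶠ v in cofinite, ∀ β : Multiset ℂ, σ₀.1.HasSatakeParamAt v β →
          β.map (fun b => (if ∃ w : HeightOneSpectrum (𝓞 L),
              w.asIdeal.under (𝓞 K) = v.asIdeal ∧ w.asIdeal.inertiaDeg (𝓞 K) = 1
              then (1 : ℂ) else -1) * b) = β)) →
      (∀ᶠ v in cofinite, ∀ α β : Multiset ℂ, π.1.HasSatakeParamAt v α → σ₀.1.HasSatakeParamAt v β →
        ∃ d : ℂ, ν.1.HasSatakeParamAt v {d} ∧
          α = (((β ×ˢ β).map (fun p : ℂ × ℂ => p.1 * p.2⁻¹)).erase 1).map (fun c => d * c)) →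
      ∃ p₁ p₂ c : (K →+* ℂ) → ℂ,
        σ₀.1.HasArchParameter (fun ι => {p₁ ι, p₂ ι}) ∧
        (∀ ι, ∃ m : ℤ, p₁ ι - p₁ (ComplexEmbedding.conjugate ι) = m) ∧
        ν.1.HasArchParameter (fun ι => {c ι}) ∧
        π.1.HasArchParameter (fun ι => {p₁ ι - p₂ ι + c ι, c ι, p₂ ι - p₁ ι + c ι}) := by
  sorry

/-- **STUB P — `stub_purity` (L; any number field; INPUT or provable engine).**  Archimedean purity of a
regular algebraic cuspidal `π` on `GL_n(𝔸_K)` on its Harish-Chandra parameter: there is `w ∈ ℤ` with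
`A ῑ = {w - a : a ∈ A ι}` at every embedding.  Why plausibly true: this is clause (iii) of the tree's named
fact `Clozel1990_regularAlgebraic` (Clozel 1990, Lemme 4.9 "pureté", on MULTISETS), transported from an
infinity type to the parameter by `hasArchParameter_unique` (and `(starRingEnd ℂ).comp ι =
ComplexEmbedding.conjugate ι`, `RingHom.ext` + `ComplexEmbedding.conjugate_coe_eq`); ALTERNATIVELY it is
provable from tree material by the companion card `petersson-hermitian-parity`: the Petersson pairing is a
`𝔤`-skew Hermitian form on the cusp forms of `π` (`IsStableSubmodule.inner_uAct`,
`AutomorphyDatum.l2Pairing_lieDeriv_add_eq_zero`), so `HasArchParameter.map_neg_conj_of_skewHermitian`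
(PROVED) gives `A ῑ = {2x - ā : a ∈ A ι}`; for `π` regular algebraic the entries are real half-integers, so
`ā = a` and `2x ∈ ℤ` (needs the `|det|^{-x}` normalisation making `A_G` act unitarily — M-sized plumbing
per triage r1-2).  Used in the composition only for `n = 3`, `K` CM, to get `a ῑ = ± a ι`.
Leans on: `Clozel1990_regularAlgebraic.purity` (fact) | `HasArchParameter.map_neg_conj_of_skewHermitian`,
`hasArchParameter_unique`. [cite: Clozel1990, Lemme 4.9] -/
theorem stub_purity :
    ∀ (n : ℕ) (K : Type) [Field K] [NumberField K] (hcpt : isCompact_glFiniteIntegralLevel n K)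
      (π : CuspidalAutomorphicRepData n K hcpt) (A : (K →+* ℂ) → Multiset ℂ),
      π.1.IsRegularAlgebraic → π.1.HasArchParameter A →
      ∃ w : ℤ, ∀ ι : K →+* ℂ,
        A (ComplexEmbedding.conjugate ι) = (A ι).map (fun a => (w : ℂ) - a) := by
  sorry

/-- **STUB C — `stub_centralCharacterArch` (M; any number field, any `n ≥ 1`).**  The central character of
a cuspidal `π` on `GL_n(𝔸_K)` as a cuspidal GL(1) datum `ω` whose Harish-Chandra parameter is the SUM of
the parameter of `π` and whose Satake parameter is, a.e., the PRODUCT (= `CentralCharacterArch` of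
`SketchIdeator3.lean`, vetted by triage r1-3 as "TRUE and M-provable").  Why plausibly true: finite part
PROVED (`AutomorphicRepData.exists_centralCharacter`: `ω(ϖ_v) = ∏ α`, unramified wherever `π` is; GL(1)
datum of a Hecke character with its a.e. Satake values
`exists_cuspidal_glOne_hasSatakeParamAt_valueAtUniformizer`); archimedean part = the centre theorem
`AutomorphicRepData.centralCharacter_det_ofInfinite_expGL` (the central `x·1_n ∈ 𝔤` acts by
`Σ_w (x_w ΣA_w + x̄_w ΣA'_w)`, PROVED) read through `hasArchParameter_glOne_of_eq_smul_one` /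
`heckeCharacter_glOne_det_ofArch_expMem` (the parameter of a GL(1) datum is the differential of its Hecke
character).  The composition uses only the archimedean clause (for `σ₀`, `n = 2`: hypothesis (iv) of
`HalfIntegralTwistCM`).  Leans on: the five names above + `hasArchParameter_unique`. [cite: BorelJacquetCorvallis1979, §4.6 and 5.7] -/
theorem stub_centralCharacterArch :
    ∀ (n : ℕ) (K : Type) [Field K] [NumberField K] (hcpt : isCompact_glFiniteIntegralLevel n K)
      (h1 : isCompact_glFiniteIntegralLevel 1 K) (π : CuspidalAutomorphicRepData n K hcpt)
      (A : (K →+* ℂ) → Multiset ℂ), 0 < n → π.1.HasArchParameter A →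
      ∃ ω : CuspidalAutomorphicRepData 1 K h1,
        ω.1.HasArchParameter (fun ι => {(A ι).sum}) ∧
        ∀ᶠ v in cofinite, ∀ α : Multiset ℂ, π.1.HasSatakeParamAt v α →
          ω.1.HasSatakeParamAt v {α.prod} := by
  sorry

/-- **STUB T — `stub_twistArchShift` (M; any number field, any `n ≥ 1`).**  The twist `π ⊗ (χ ∘ det)` of a
cuspidal `π` on `GL_n(𝔸_K)` by a GL(1) datum `χ` with parameter `{s ι}`: a cuspidal datum `π'` with, a.e.,
`t_{π',v} = c_v · t_{π,v}` (`{c_v}` the Satake parameter of `χ`) AND archimedean parameter `A ι + s ι`.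
Why plausibly true: the twist and its Satake parameters are PROVED for every Hecke character
(`exists_cuspidalAutomorphicRepData_twist_hecke`, `CuspidalAutomorphicRepData.exists_twist_hecke_hasSatakeParamAt`,
with the GL(1) dictionary `exists_heckeCharacter_glOne` / `exists_eq_singleton_of_hasSatakeParamAt_glOne` /
`isUnramifiedAt_heckeCharacter_glOne` for `c_v = χ(ϖ_v)` a.e.); the archimedean shift is
`HasArchParameter.of_map_mulChar_detTwist` generalised from `‖·‖^s` (`s` real, PROVED) to an arbitrary Hecke
character: on `W·(χ∘det)` the Lie algebra acts by `ρ(X) + dχ(tr X)`, and the Harish-Chandra shift by the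
scalar differential is `HasHCParameter.of_add_smul_one` (real differential, PROVED; the complex-differential
variant "T-complex" is the one new piece — or AVOID it via the centre-readout of triage r1-2: apply stub A to
the twisted descent `σ` directly and read `HC(σ) = {(Σ_σ ± a)/2}` off stub C).  Leans on: the names above +
`hasArchParameter_glOne_of_eq_smul_one`, `heckeCharacter_glOne_det_ofArch_expMem`. [cite: BorelJacquet1979, 5.7] [cite: ArthurClozelAMS120, Ch. 3, proof of Thm. 3.1] -/
theorem stub_twistArchShift :
    ∀ (n : ℕ) (K : Type) [Field K] [NumberField K] (hcpt : isCompact_glFiniteIntegralLevel n K)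
      (h1 : isCompact_glFiniteIntegralLevel 1 K) (π : CuspidalAutomorphicRepData n K hcpt)
      (χ : CuspidalAutomorphicRepData 1 K h1) (A : (K →+* ℂ) → Multiset ℂ) (s : (K →+* ℂ) → ℂ),
      0 < n → π.1.HasArchParameter A → χ.1.HasArchParameter (fun ι => {s ι}) →
      ∃ π' : CuspidalAutomorphicRepData n K hcpt,
        (∀ᶠ v in cofinite, ∀ β : Multiset ℂ, π.1.HasSatakeParamAt v β →
          ∃ c : ℂ, χ.1.HasSatakeParamAt v {c} ∧ π'.1.HasSatakeParamAt v (β.map (fun b => c * b))) ∧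
        π'.1.HasArchParameter (fun ι => (A ι).map (fun x => x + s ι)) := by
  sorry

/-- **STUB R — `stub_raCertificate` (M; any number field, any `n`).**  Regular algebraicity is decided on
the Harish-Chandra parameter alone: if `π` (cuspidal on `GL_n(𝔸_K)`) has archimedean parameter `A` with
`n` PAIRWISE DISTINCT entries in `(n-1)/2 + ℤ` at every embedding, then `π` is regular algebraic
(= `isRegularAlgebraic_of_hasArchParameter_halfInt` of the card, all `n`).  Why plausibly true: the tree's
`IsRegularAlgebraic` asks for a well-formed infinity type `T` (card `n` + conjugation-swap) whose
`a`-multisets ARE the parameter, with `a, b ∈ (n-1)/2 + ℤ` and the `a`'s `Nodup`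
(`InfinityType.IsWellFormed/IsCAlgebraic/IsRegular`, `AutomorphicRepData.HasInfinityType`); construct `T`
place by place: at a complex place `w` with chosen embedding `e_w = w.embedding`, zip the lists of `A e_w`
and `A ē_w` into weights `(a, b)` (`a - b ∈ ℤ` since both lie in `(n-1)/2 + ℤ`) and put the swaps at `ē_w`;
at a real place pair each `a` with itself (swap-stable); every `ι` is `e_w` or `ē_w`
(`InfinitePlace.mk_embedding`, `mk_eq_iff`, `ComplexEmbedding.conjugate_conjugate`).  Pure bookkeeping on
`InfinityType`, but a genuine M-sized lemma (choice of representatives per place).  Leans on: the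
definitions above; Mathlib `NumberField.InfinitePlace.embedding`, `mk_eq_iff`, `isReal_or_isComplex`.
[cite: Clozel1990, Déf. 1.8 and 3.12] [cite: BuzzardGee2014, §3.1] -/
theorem stub_raCertificate :
    ∀ (n : ℕ) (K : Type) [Field K] [NumberField K] (hcpt : isCompact_glFiniteIntegralLevel n K)
      (π : CuspidalAutomorphicRepData n K hcpt) (A : (K →+* ℂ) → Multiset ℂ),
      π.1.HasArchParameter A → (∀ ι, Multiset.card (A ι) = n) → (∀ ι, (A ι).Nodup) →
      (∀ ι, ∀ x ∈ A ι, ∃ k : ℤ, x = k + ((n : ℂ) - 1) / 2) → π.1.IsRegularAlgebraic := by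
  sorry

/-! ## §2 The statements of the line as named `Prop`s, name-keyed aliases, consistency -/

/-- Statement of STUB A. -/
def AdjointArchShape : Prop :=
  ∀ (K : Type) [Field K] [NumberField K] (h1 : isCompact_glFiniteIntegralLevel 1 K)
    (h2 : isCompact_glFiniteIntegralLevel 2 K) (h3 : isCompact_glFiniteIntegralLevel 3 K)
    (π : CuspidalAutomorphicRepData 3 K h3) (σ₀ : CuspidalAutomorphicRepData 2 K h2)
    (ν : CuspidalAutomorphicRepData 1 K h1),
    (∀ (L : Type) [Field L] [NumberField L] [Algebra K L], Module.finrank K L = 2 →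
      ¬ (∀ᶠ v in cofinite, ∀ β : Multiset ℂ, σ₀.1.HasSatakeParamAt v β →
        β.map (fun b => (if ∃ w : HeightOneSpectrum (𝓞 L),
            w.asIdeal.under (𝓞 K) = v.asIdeal ∧ w.asIdeal.inertiaDeg (𝓞 K) = 1
            then (1 : ℂ) else -1) * b) = β)) →
    (∀ᶠ v in cofinite, ∀ α β : Multiset ℂ, π.1.HasSatakeParamAt v α → σ₀.1.HasSatakeParamAt v β →
      ∃ d : ℂ, ν.1.HasSatakeParamAt v {d} ∧
        α = (((β ×ˢ β).map (fun p : ℂ × ℂ => p.1 * p.2⁻¹)).erase 1).map (fun c => d * c)) →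
    ∃ p₁ p₂ c : (K →+* ℂ) → ℂ,
      σ₀.1.HasArchParameter (fun ι => {p₁ ι, p₂ ι}) ∧
      (∀ ι, ∃ m : ℤ, p₁ ι - p₁ (ComplexEmbedding.conjugate ι) = m) ∧
      ν.1.HasArchParameter (fun ι => {c ι}) ∧
      π.1.HasArchParameter (fun ι => {p₁ ι - p₂ ι + c ι, c ι, p₂ ι - p₁ ι + c ι})

/-- Statement of STUB P. -/
def Purity : Prop :=
  ∀ (n : ℕ) (K : Type) [Field K] [NumberField K] (hcpt : isCompact_glFiniteIntegralLevel n K)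
    (π : CuspidalAutomorphicRepData n K hcpt) (A : (K →+* ℂ) → Multiset ℂ),
    π.1.IsRegularAlgebraic → π.1.HasArchParameter A →
    ∃ w : ℤ, ∀ ι : K →+* ℂ,
      A (ComplexEmbedding.conjugate ι) = (A ι).map (fun a => (w : ℂ) - a)

/-- Statement of STUB C. -/
def CentralCharacterArch : Prop :=
  ∀ (n : ℕ) (K : Type) [Field K] [NumberField K] (hcpt : isCompact_glFiniteIntegralLevel n K)
    (h1 : isCompact_glFiniteIntegralLevel 1 K) (π : CuspidalAutomorphicRepData n K hcpt)
    (A : (K →+* ℂ) → Multiset ℂ), 0 < n → π.1.HasArchParameter A →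
    ∃ ω : CuspidalAutomorphicRepData 1 K h1,
      ω.1.HasArchParameter (fun ι => {(A ι).sum}) ∧
      ∀ᶠ v in cofinite, ∀ α : Multiset ℂ, π.1.HasSatakeParamAt v α →
        ω.1.HasSatakeParamAt v {α.prod}

/-- Statement of STUB T. -/
def TwistArchShift : Prop :=
  ∀ (n : ℕ) (K : Type) [Field K] [NumberField K] (hcpt : isCompact_glFiniteIntegralLevel n K)
    (h1 : isCompact_glFiniteIntegralLevel 1 K) (π : CuspidalAutomorphicRepData n K hcpt)
    (χ : CuspidalAutomorphicRepData 1 K h1) (A : (K →+* ℂ) → Multiset ℂ) (s : (K →+* ℂ) → ℂ),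
    0 < n → π.1.HasArchParameter A → χ.1.HasArchParameter (fun ι => {s ι}) →
    ∃ π' : CuspidalAutomorphicRepData n K hcpt,
      (∀ᶠ v in cofinite, ∀ β : Multiset ℂ, π.1.HasSatakeParamAt v β →
        ∃ c : ℂ, χ.1.HasSatakeParamAt v {c} ∧ π'.1.HasSatakeParamAt v (β.map (fun b => c * b))) ∧
      π'.1.HasArchParameter (fun ι => (A ι).map (fun x => x + s ι))

/-- Statement of STUB R. -/
def RACertificate : Prop :=
  ∀ (n : ℕ) (K : Type) [Field K] [NumberField K] (hcpt : isCompact_glFiniteIntegralLevel n K)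
    (π : CuspidalAutomorphicRepData n K hcpt) (A : (K →+* ℂ) → Multiset ℂ),
    π.1.HasArchParameter A → (∀ ι, Multiset.card (A ι) = n) → (∀ ι, (A ι).Nodup) →
    (∀ ι, ∀ x ∈ A ι, ∃ k : ℤ, x = k + ((n : ℂ) - 1) / 2) → π.1.IsRegularAlgebraic

/-! Consistency: each named statement IS its registered stub (syntactically the same `Prop`). -/

theorem adjointArchShape_of_stub : AdjointArchShape := stub_adjointArchShape
theorem purity_of_stub : Purity := stub_purity
theorem centralCharacterArch_of_stub : CentralCharacterArch := stub_centralCharacterArch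
theorem twistArchShift_of_stub : TwistArchShift := stub_twistArchShift
theorem raCertificate_of_stub : RACertificate := stub_raCertificate

/-! Name-keyed aliases of the five statements (the hypotheses of the composition: the skeleton audit
admits a hypothesis only if its head constant is a registered obligation — such as the route item
`HalfIntegralTwistCM` — or is named like a declared stub). -/
namespace Registered

/-- Alias of `AdjointArchShape` keyed by the registered stub name. -/
abbrev stub_adjointArchShape : Prop := AdjointArchShape
/-- Alias of `Purity` keyed by the registered stub name. -/
abbrev stub_purity : Prop := Purity
/-- Alias of `CentralCharacterArch` keyed by the registered stub name. -/
abbrev stub_centralCharacterArch : Prop := CentralCharacterArch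
/-- Alias of `TwistArchShift` keyed by the registered stub name. -/
abbrev stub_twistArchShift : Prop := TwistArchShift
/-- Alias of `RACertificate` keyed by the registered stub name. -/
abbrev stub_raCertificate : Prop := RACertificate

end Registered

/-! ## §3 Proved lemmas: Satake transport along a twist (Disproof §3, re-proved) and the readout -/

section Satake

/-- Rankin–Selberg data are blind to a common twist: `{(ca)(cb)⁻¹} = {ab⁻¹}` (`c ≠ 0`). -/
theorem rsData_map_mul (s t : Multiset ℂ) {c : ℂ} (hc : c ≠ 0) :
    rsData (s.map (c * ·)) (t.map (c * ·)) = rsData s t := by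
  induction s using Multiset.induction_on with
  | empty => simp [rsData_zero]
  | cons a s ih =>
      rw [Multiset.map_cons, rsData_cons, rsData_cons, ih, Multiset.map_map]
      congr 1
      refine Multiset.map_congr rfl fun y _ => ?_
      simp only [Function.comp_apply]
      rw [mul_inv, mul_mul_mul_comm, mul_inv_cancel₀ hc, one_mul]

/-- **`Ad` is twist-invariant**: `Ad(c · β) = Ad(β)` for `c ≠ 0`. -/
theorem adParams_map_mul (β : Multiset ℂ) {c : ℂ} (hc : c ≠ 0) :
    adParams (β.map (c * ·)) = adParams β := by
  change (rsData _ _).erase 1 = (rsData _ _).erase 1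
  rw [rsData_map_mul β β hc]

variable {K : Type} [Field K] [NumberField K] {h1 : isCompact_glFiniteIntegralLevel 1 K}
  {h2 : isCompact_glFiniteIntegralLevel 2 K} {h3 : isCompact_glFiniteIntegralLevel 3 K}

/-- A GL(1) Satake value is non-zero (`HasSatakeParamAt.zero_not_mem`). -/
theorem ne_zero_of_hasSatakeParamAt_singleton {χ : CuspidalAutomorphicRepData 1 K h1}
    {v : HeightOneSpectrum (𝓞 K)} {c : ℂ} (h : χ.1.HasSatakeParamAt v {c}) : c ≠ 0 :=
  fun h0 => h.zero_not_mem (by simp [h0])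

/-- **The adjoint relation is invariant under a.e. Satake twists of `σ`** (Flath uniqueness and a.e.
unramifiedness, both PROVED in the tree, and `adParams_map_mul`). -/
theorem adRel_of_isSatakeTwistOf {π : CuspidalAutomorphicRepData 3 K h3}
    {σ σ₀ : CuspidalAutomorphicRepData 2 K h2} {ν χ : CuspidalAutomorphicRepData 1 K h1}
    (h : AdRel π σ₀ ν) (htw : IsSatakeTwistOf σ σ₀ χ) : AdRel π σ ν := by
  have hcof : ∀ᶠ v in cofinite, σ₀.1.IsUnramifiedAt v := σ₀.1.hasSatakeParamAt_cofinite_holds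
  filter_upwards [h, htw, hcof] with v hv htv hur α β hα hβ
  obtain ⟨β₀, hβ₀⟩ := hur
  obtain ⟨c, hc, hσ⟩ := htv β₀ hβ₀
  have hββ : β = β₀.map (c * ·) := σ.1.hasSatakeParamAt_unique_holds hβ hσ
  obtain ⟨d, hd, hαd⟩ := hv α β₀ hα hβ₀
  exact ⟨d, hd, by rw [hαd, hββ, adParams_map_mul β₀ (ne_zero_of_hasSatakeParamAt_singleton hc)]⟩

/-- **Non-dihedrality is invariant under a.e. Satake twists** (`Multiset.map (c * ·)` is injective for
`c ≠ 0`). -/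
theorem nonDihedral_of_isSatakeTwistOf {σ σ₀ : CuspidalAutomorphicRepData 2 K h2}
    {χ : CuspidalAutomorphicRepData 1 K h1} (h : NonDihedral σ₀) (htw : IsSatakeTwistOf σ σ₀ χ) :
    NonDihedral σ := by
  intro L _ _ _ hL hdi
  refine h L hL ?_
  filter_upwards [hdi, htw] with v hv htv β₀ hβ₀
  obtain ⟨c, hc, hσ⟩ := htv β₀ hβ₀
  have hc0 : c ≠ 0 := ne_zero_of_hasSatakeParamAt_singleton hc
  have key := hv (β₀.map (c * ·)) hσ
  rw [Multiset.map_map] at key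
  have key' : (β₀.map fun b => quadSign L v * b).map (c * ·) = β₀.map (c * ·) := by
    rw [Multiset.map_map]
    refine Eq.trans (Multiset.map_congr rfl fun b _ => ?_) key
    simp only [Function.comp_apply]
    ring
  exact Multiset.map_injective (mul_right_injective₀ hc0) key'

end Satake

/-- **Readout of regular algebraicity on the archimedean parameter** (Harish-Chandra uniqueness,
`hasArchParameter_unique`, PROVED): if `π` is regular algebraic and has archimedean parameter `A`, then at
every embedding `A ι` has pairwise distinct entries, all in `(n-1)/2 + ℤ`. -/
theorem readout {n : ℕ} {K : Type} [Field K] [NumberField K] {hcpt : isCompact_glFiniteIntegralLevel n K}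
    {π : AutomorphicRepData (AutomorphyDatum.gl n K hcpt)} (hπ : π.IsRegularAlgebraic)
    {A : (K →+* ℂ) → Multiset ℂ} (hA : π.HasArchParameter A) (ι : K →+* ℂ) :
    (A ι).Nodup ∧ ∀ x ∈ A ι, ∃ k : ℤ, x = k + ((n : ℂ) - 1) / 2 := by
  obtain ⟨T, ⟨hwf, hTA⟩, hCalg, hreg⟩ := hπ
  obtain rfl : A = fun σ => (T σ).map ArchWeight.a := π.hasArchParameter_unique hA hTA
  refine ⟨hreg ι, fun x hx => ?_⟩
  obtain ⟨q, hq, rfl⟩ := Multiset.mem_map.mp hx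
  obtain ⟨k, l, hk, -⟩ := hCalg ι q hq
  exact ⟨k, hk⟩

/-! ## §4 The composition: the five stubs and the route item `HalfIntegralTwistCM` imply the crux, by name -/

set_option maxHeartbeats 800000 in
/-- **The line concludes the crux.**
`stub_adjointArchShape → stub_purity → stub_centralCharacterArch → stub_twistArchShift →
stub_raCertificate → HalfIntegralTwistCM → RegularAdjointLiftCM`, kernel-checked (the only `sorry`s of the
file are inside the five stubs; `HalfIntegralTwistCM` is the route's rank-4 item stmt-Langlands-14036, an
admissible registered obligation).  `IsCMField K` is used exactly once (the call of `HalfIntegralTwistCM`);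
`π.IsRegularAlgebraic` exactly where `readout` is called. -/
theorem RegularAdjointLiftCM_of (hA : Registered.stub_adjointArchShape) (hP : Registered.stub_purity)
    (hC : Registered.stub_centralCharacterArch) (hT : Registered.stub_twistArchShift)
    (hR : Registered.stub_raCertificate) (h₄ : HalfIntegralTwistCM) :
    Summit.Langlands.Langlands.Theses.IrreducibilityBySelfDuality.RegularAdjointLiftCM := by
  intro hThmA K _ _ hK h1 h2 h3 π hπ hη
  obtain ⟨η, hη⟩ := hη
  obtain ⟨σ₀, ν, hnd, hrel⟩ := hThmA K h1 h2 h3 π η hη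
  -- Satake level: `t_π = ν · Ad(t_{σ₀})` a.e. (Satake uniqueness, Flath — PROVED)
  have had : AdRel π σ₀ ν := by
    filter_upwards [hrel] with v hv α β hα hβ
    obtain ⟨d, e, hd, -, -, hPv⟩ := hv β hβ
    exact ⟨d, hd, π.1.hasSatakeParamAt_unique_holds hα hPv⟩
  -- STUB A: the archimedean shape of the descent
  obtain ⟨p₁, p₂, c, hσ₀A, hpair, hνA, hπA⟩ := hA K h1 h2 h3 π σ₀ ν hnd had
  -- readout of `π` regular algebraic: `c ι ∈ ℤ`, `a ι = p₁ ι - p₂ ι ∈ ℤ ∖ {0}`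
  have hcZ : ∀ ι, ∃ k : ℤ, c ι = k := by
    intro ι
    obtain ⟨k, hk⟩ := (readout hπ hπA ι).2 (c ι) (by simp)
    refine ⟨k + 1, ?_⟩
    push_cast at hk ⊢
    linear_combination hk
  have haZ : ∀ ι, ∃ k : ℤ, p₁ ι - p₂ ι = k := by
    intro ι
    obtain ⟨k, hk⟩ := (readout hπ hπA ι).2 (p₁ ι - p₂ ι + c ι) (by simp)
    obtain ⟨k', hk'⟩ := hcZ ι
    refine ⟨k + 1 - k', ?_⟩
    push_cast at hk ⊢
    linear_combination hk - hk'
  have ha0 : ∀ ι, p₁ ι ≠ p₂ ι := by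
    intro ι heq
    exact absurd (readout hπ hπA ι).1 (by simp [heq])
  -- STUB P: purity of `π` forces `a ῑ = ± a ι`, hence `a ι + a ῑ` is even
  obtain ⟨w, hw⟩ := hP 3 K h3 π _ hπ hπA
  have hpar : ∀ ι, ∃ m : ℤ, (p₁ ι - p₂ ι) +
      (p₁ (ComplexEmbedding.conjugate ι) - p₂ (ComplexEmbedding.conjugate ι)) = 2 * m := by
    intro ι
    have h := hw ι
    simp only [Multiset.insert_eq_cons, Multiset.map_cons, Multiset.map_singleton] at h
    have hs := congrArg Multiset.sum h
    have hq := congrArg (fun m : Multiset ℂ => (m.map (fun x => x ^ 2)).sum) h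
    simp only [Multiset.sum_cons, Multiset.sum_singleton, Multiset.map_cons,
      Multiset.map_singleton] at hs hq
    have hc' : c (ComplexEmbedding.conjugate ι) = (w : ℂ) - c ι := by
      linear_combination hs / 3
    have hsq : (p₁ (ComplexEmbedding.conjugate ι) - p₂ (ComplexEmbedding.conjugate ι)) ^ 2 =
        (p₁ ι - p₂ ι) ^ 2 := by
      linear_combination hq / 2 -
        (3 / 2 : ℂ) * (c (ComplexEmbedding.conjugate ι) + ((w : ℂ) - c ι)) * hc'
    rcases sq_eq_sq_iff_eq_or_eq_neg.mp hsq with h' | h'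
    · obtain ⟨k, hk⟩ := haZ ι
      exact ⟨k, by rw [h', hk]; ring⟩
    · exact ⟨0, by rw [h']; simp⟩
  -- STUB C: the central character `ω_{σ₀}` as a GL(1) datum with parameter `{p₁ + p₂}`
  obtain ⟨ω, hω, -⟩ := hC 2 K h2 h1 σ₀ _ two_pos hσ₀A
  have hω' : ω.1.HasArchParameter (fun ι => {p₁ ι + p₂ ι}) := by simpa using hω
  -- the route item r4 `HalfIntegralTwistCM` (THE LEVER; the only use of `IsCMField K`)
  obtain ⟨χ, p, hχ, hp⟩ := h₄ K hK h1 p₁ p₂ haZ hpair hpar ⟨ω, hω'⟩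
  -- STUB T: the twist `σ = σ₀ ⊗ χ`, its Satake and archimedean parameters
  obtain ⟨σ, htw, hσA⟩ := hT 2 K h2 h1 σ₀ χ _ p two_pos hσ₀A hχ
  have hσA' : σ.1.HasArchParameter (fun ι => {p₁ ι + p ι, p₂ ι + p ι}) := by simpa using hσA
  refine ⟨σ, ν, ?_, ?_, nonDihedral_of_isSatakeTwistOf hnd htw, adRel_of_isSatakeTwistOf had htw⟩
  · -- STUB R (n = 2): `σ` is regular algebraic — parameters in `1/2 + ℤ`, distinct since `a ≠ 0`
    refine hR 2 K h2 σ _ hσA' (fun ι => by simp) (fun ι => ?_) (fun ι x hx => ?_)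
    · have hne : p₁ ι + p ι ≠ p₂ ι + p ι := fun h => ha0 ι (add_right_cancel h)
      simp [hne]
    · obtain ⟨m, hm⟩ := hp ι
      obtain ⟨k, hk⟩ := haZ ι
      simp only [Multiset.insert_eq_cons, Multiset.mem_cons, Multiset.mem_singleton] at hx
      rcases hx with rfl | rfl
      · exact ⟨m, by push_cast; linear_combination hm⟩
      · exact ⟨m - k, by push_cast; linear_combination hm - hk⟩
  · -- STUB R (n = 1): `ν` is algebraic — its parameter `c ι` is integral
    refine hR 1 K h1 ν _ hνA (fun ι => by simp) (fun ι => by simp) (fun ι x hx => ?_)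
    obtain ⟨k, hk⟩ := hcZ ι
    simp only [Multiset.mem_singleton] at hx
    subst hx
    exact ⟨k, by push_cast; linear_combination hk⟩

/-- Wiring check: the registered stubs (and a proof of the route item r4) feed `RegularAdjointLiftCM_of`
as stated. -/
example (h₄ : HalfIntegralTwistCM) :
    Summit.Langlands.Langlands.Theses.IrreducibilityBySelfDuality.RegularAdjointLiftCM :=
  RegularAdjointLiftCM_of stub_adjointArchShape stub_purity stub_centralCharacterArch
    stub_twistArchShift stub_raCertificate h₄

end Summit.Langlands.Langlands.Cruxes.RegularAdjointLiftCM.HalfCentralCharacter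

end
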